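import Literature.NumberTheory.DiophantineGeometry.WordModelSelfDuality
import HarnessLib

/-!
# The matrix power trace `Pow^n_m = tr(X^n)`: stabilizing elements and their action on
# `(E ⊗ F)^{⊗D}`

Gesmundo–Ikenmeyer–Panova (2017), Thm. 7: for the generic `m × m` matrix `X`,
"`tr(X^m) = tr((X^t)^m)` and `tr(X^m) = tr((gXg⁻¹)^m)`, where `g ∈ GL_n` ... Moreover, if
`n, m ≥ 3`, the whole stabilizer `𝒮` of `Pow^m_n` is generated by these symmetries" (and the
`m`-th roots of unity). This file defines the power trace as a form (`powTrace k m n` in the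
variables `Fin m × Fin m`, `powFormLex k m n` in the lexicographically ordered matrix variables
`MatIdx m` of the tree's orbit-closure machinery; the `ℂ`-only `Literature.Barriers.PneNP.powTraceFormLex`
of the barrier catalogue, downstream of this file, is the same object — the identification is
stated and checked as `powTraceFormLex_eq_powFormLex` in
`Literature/Barriers/ValiantsHypothesis/GCTMatrixPoweringProofs.lean`) and PROVES the easy half of
Thm. 7 that an upper bound on multiplicities needs — conjugations and the transposition stabilise
`tr(X^n)`:

* `linSubst_kronecker_powTrace`: the substitution by a Kronecker product `a ⊗ b` sends
  `tr(X^n)` to `tr((aᵀ X b)^n)`; with `b = (a⁻¹)ᵀ` this is `tr(X^n)`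
  (`linSubst_kronecker_powTrace_conj`), and transported to `MatIdx m`:
  `linSubstRep_reindexGL_kronFin_powFormLex`;
* `rename_swap_powTrace`, `linSubstRep_reindexGL_swapGL_powFormLex`: the transposition
  `X ↦ Xᵀ` (the permutation matrix `swapGL` of the letters of `Fin (m*m) ≃ Fin m × Fin m`)
  stabilises `tr(X^n)`.

It then computes the action of these elements on the word model of `W^{⊗D}`, `W = E ⊗ F = k^{m²}`,
through the matrix `splitMat x` of a vector `x` (rows and columns indexed by `E`-words and
`F`-words, `DetStabilizerKronecker.splitFun`): `a ⊗ b` acts by `M ↦ a^{⊗D} M (b^{⊗D})ᵀ`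
(`splitMat_wordRep_kronFin`), so a vector fixed by all `a ⊗ (a⁻¹)ᵀ` has a matrix commuting with
`GL_m` (`isGLCommuting_splitMat_of_fixed`), and a vector fixed by the transposition has a
symmetric matrix (`splitMat_transpose_of_swap_fixed`). No statement about the full stabilizer
(the hard half of Thm. 7) is made or needed.

## References

* F. Gesmundo, C. Ikenmeyer, G. Panova, *Geometric complexity theory and matrix powering*,
  Diff. Geom. Appl. 55 (2017) 106–127 = arXiv:1611.00827, §2.2 (`Pow^m_n := tr(X^m)`), Thm. 7,
  §4 (`V = E^* ⊗ E`, `τ`, `PGL(E)`). [GesmundoIkenmeyerPanova2017]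
* P. Bürgisser, J. M. Landsberg, L. Manivel, J. Weyman, SIAM J. Comput. 40 (2011), §5.2 (the
  analogous stabilizer computation for `det_n`, tree file `DetStabilizerKronecker`). [BLMW2011]

## Mathlib and tree

Used from Mathlib: `Matrix.mvPolynomialX`, `Matrix.trace` (`trace_mul_cycle`,
`trace_transpose`), `Matrix.transpose_pow`, `AlgHom.mapMatrix`, `Matrix.kroneckerMap`,
`Equiv.Perm.permMatrix` (`Matrix.permMatrix_mul`, `permMatrix_one`), `MvPolynomial.rename`.
From the tree: `linSubst` (`linSubst_X`, `linSubst_permMatrix`), `rename_linSubst`, `kronFin`,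
`coe_reindexGL_kronFin`, `reindexGL`, `matIdxEquiv`, `splitFun`, `splitWord`,
`splitFun_wordRep_kronFin`, `kronPow` (`kronPow_mul`, `kronPow_one`, `kronPow_transpose`,
`kronPow_eq_tensorPowerMatrix`), `transposeGL`, `IsGLCommuting`. The entrywise lemma
`permMatrix_apply'` duplicates (for a general index type) a `Fin n` lemma of the same name in
`Literature/NumberTheory/Automorphic/…/HeckeTransversalGL.lean`, whose valuation-theoretic
imports are not wanted here; a later refactor may move the general lemma next to
`linSubst_permMatrix` (`LinSubst.lean`).

## Design

`namespace Literature.NumberTheory.DiophantineGeometry`; letters as in the barrier file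
`GCTMatrixPowering` (matrix size `m`, exponent = permanent size `n`); `k` any field (the
stabilizer identities are characteristic-free and hold for every `n`, trivially for `n = 0` where
`tr(X^0) = m` is a constant).
-/

noncomputable section

open scoped BigOperators Matrix Kronecker
open MvPolynomial

namespace Literature.NumberTheory.DiophantineGeometry

/-! ### The power trace and its stabilizing substitutions -/

section PowTrace

variable (k : Type*) [Field k] (m : ℕ)

/-- The matrix power trace `Pow^n_m = tr(X^n)` of the generic `m × m` matrix `X = (X_{ij})`, a
form of degree `n` in the `m²` variables `Fin m × Fin m`. "Let `Pow^m_n := tr(X^m) ∈ 𝔸^m_n`,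
where `X = (X_{i,j})` is the `n × n` variable matrix" (GIP letters swapped).
[cite: GesmundoIkenmeyerPanova2017, §2.2 (definition of Pow)] -/
def powTrace (n : ℕ) : MvPolynomial (Fin m × Fin m) k :=
  ((Matrix.mvPolynomialX (Fin m) (Fin m) k) ^ n).trace

/-- The power trace in the lexicographically ordered matrix variables `MatIdx m` (the variables
of the tree's `GL (MatIdx m) k`-orbit closures; the barrier catalogue's `ℂ`-only
`Literature.Barriers.PneNP.powTraceFormLex m n` is the same object, see
`powTraceFormLex_eq_powFormLex` downstream). [cite: GesmundoIkenmeyerPanova2017, §2.2 (definition of Pow)] -/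
def powFormLex (n : ℕ) : MvPolynomial (MatIdx m) k :=
  rename toLex (powTrace k m n)

variable {k m}

/-- An algebra homomorphism applied to the trace of a matrix power: `φ(tr(X^n)) = tr((φ X)^n)`.
[folklore] -/
theorem algHom_trace_pow {R A B : Type*} [CommSemiring R] [CommSemiring A] [CommSemiring B]
    [Algebra R A] [Algebra R B] {ι : Type*} [Fintype ι] [DecidableEq ι] (φ : A →ₐ[R] B)
    (X : Matrix ι ι A) (n : ℕ) : φ ((X ^ n).trace) = ((φ.mapMatrix X) ^ n).trace := by
  rw [← map_pow, AlgHom.mapMatrix_apply, Matrix.trace, Matrix.trace, map_sum]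
  rfl

/-- The linear substitution by a Kronecker product `a ⊗ b` (variables `Fin m × Fin m`, column
convention `X_{(i,j)} ↦ ∑ (a ⊗ b)_{(i',j'),(i,j)} X_{(i',j')}`) sends the generic matrix `X` to
`aᵀ X b` (as in `DetStabilizerKronecker.linSubst_kronecker_detPoly`). [folklore] -/
theorem mapMatrix_linSubst_kronecker (a b : Matrix (Fin m) (Fin m) k) :
    (Literature.Computability.AlgebraicComplexity.linSubst (Fin m × Fin m) k (a ⊗ₖ b)).mapMatrix
        (Matrix.mvPolynomialX (Fin m) (Fin m) k) =
      (aᵀ).map (C : k →+* MvPolynomial (Fin m × Fin m) k) * Matrix.mvPolynomialX (Fin m) (Fin m) k *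
        b.map (C : k →+* MvPolynomial (Fin m × Fin m) k) := by
  refine Matrix.ext fun i j => ?_
  rw [AlgHom.mapMatrix_apply, Matrix.map_apply, Matrix.mvPolynomialX_apply,
    Literature.Computability.AlgebraicComplexity.linSubst_X]
  simp only [Matrix.mul_apply, Matrix.map_apply, Matrix.transpose_apply,
    Matrix.mvPolynomialX_apply, Matrix.kroneckerMap_apply, Finset.sum_mul]
  rw [Fintype.sum_prod_type, Finset.sum_comm]
  refine Finset.sum_congr rfl fun y _ => Finset.sum_congr rfl fun x _ => ?_
  rw [smul_eq_C_mul, map_mul]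
  ring

/-- **`(a ⊗ b) · tr(X^n) = tr((aᵀ X b)^n)`.** [folklore] -/
theorem linSubst_kronecker_powTrace (a b : Matrix (Fin m) (Fin m) k) (n : ℕ) :
    Literature.Computability.AlgebraicComplexity.linSubst (Fin m × Fin m) k (a ⊗ₖ b)
        (powTrace k m n) =
      (((aᵀ).map (C : k →+* MvPolynomial (Fin m × Fin m) k) * Matrix.mvPolynomialX (Fin m) (Fin m) k *
        b.map (C : k →+* MvPolynomial (Fin m × Fin m) k)) ^ n).trace := by
  rw [powTrace, algHom_trace_pow, mapMatrix_linSubst_kronecker]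

/-- Powers of a conjugate: `(P X Q)^(n+1) = P X^(n+1) Q` when `Q P = 1`. [folklore] -/
theorem conj_pow_succ {R : Type*} [Semiring R] {ι : Type*} [Fintype ι] [DecidableEq ι]
    (P X Q : Matrix ι ι R) (hQP : Q * P = 1) (n : ℕ) :
    (P * X * Q) ^ (n + 1) = P * X ^ (n + 1) * Q := by
  induction n with
  | zero => rw [zero_add, pow_one, pow_one]
  | succ n ih =>
    rw [pow_succ, ih, pow_succ _ (n + 1)]
    simp only [Matrix.mul_assoc]
    rw [← Matrix.mul_assoc Q P, hQP, Matrix.one_mul]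

/-- **Conjugation stabilises the power trace** (GIP Thm. 7, "`tr(X^m) = tr((gXg⁻¹)^m)`"): the
substitution by `a ⊗ (a⁻¹)ᵀ`, i.e. `X ↦ aᵀ X (aᵀ)⁻¹`, fixes `tr(X^n)` (for `n = 0` trivially:
`tr(X^0) = m` is a constant). [cite: GesmundoIkenmeyerPanova2017, Thm. 7] -/
theorem linSubst_kronecker_powTrace_conj (a : GL (Fin m) k) (n : ℕ) :
    Literature.Computability.AlgebraicComplexity.linSubst (Fin m × Fin m) k
        ((a : Matrix (Fin m) (Fin m) k) ⊗ₖ ((a⁻¹ : GL (Fin m) k) : Matrix (Fin m) (Fin m) k)ᵀ)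
        (powTrace k m n) = powTrace k m n := by
  rcases n with _ | n
  · rw [powTrace, algHom_trace_pow, pow_zero, pow_zero]
  rw [linSubst_kronecker_powTrace]
  set P := ((a : Matrix (Fin m) (Fin m) k)ᵀ).map (C : k →+* MvPolynomial (Fin m × Fin m) k) with hP
  set Q := (((a⁻¹ : GL (Fin m) k) : Matrix (Fin m) (Fin m) k)ᵀ).map
    (C : k →+* MvPolynomial (Fin m × Fin m) k) with hQ
  have hQP : Q * P = 1 := by
    rw [hP, hQ, ← RingHom.mapMatrix_apply, ← RingHom.mapMatrix_apply, ← map_mul,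
      ← Matrix.transpose_mul, ← Units.val_mul, mul_inv_cancel, Units.val_one, Matrix.transpose_one,
      map_one]
  rw [conj_pow_succ _ _ _ hQP, Matrix.trace_mul_cycle, hQP, Matrix.one_mul, powTrace]

/-- **The transposition stabilises the power trace** (GIP Thm. 7, "`tr(X^m) = tr((X^t)^m)`"):
renaming `X_{(i,j)} ↦ X_{(j,i)}` fixes `tr(X^n)`. [cite: GesmundoIkenmeyerPanova2017, Thm. 7] -/
theorem rename_swap_powTrace (n : ℕ) :
    rename Prod.swap (powTrace k m n) = powTrace k m n := by
  rw [powTrace, algHom_trace_pow]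
  have h : (rename (Prod.swap : Fin m × Fin m → Fin m × Fin m) :
      MvPolynomial (Fin m × Fin m) k →ₐ[k] MvPolynomial (Fin m × Fin m) k).mapMatrix
        (Matrix.mvPolynomialX (Fin m) (Fin m) k) = (Matrix.mvPolynomialX (Fin m) (Fin m) k)ᵀ := by
    refine Matrix.ext fun i j => ?_
    rw [AlgHom.mapMatrix_apply, Matrix.map_apply, Matrix.mvPolynomialX_apply, rename_X,
      Matrix.transpose_apply, Matrix.mvPolynomialX_apply, Prod.swap_prod_mk]
  rw [h, ← Matrix.transpose_pow, Matrix.trace_transpose]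

end PowTrace

/-! ### The stabilizing elements in `GL_{m²}` and their action on `W^{⊗D}` -/

section Stabilizer

variable (k : Type*) [Field k] (m : ℕ)

/-- The permutation of the alphabet `Fin (m*m) ≃ Fin m × Fin m` (enumeration
`finProdFinEquiv`, as in `kronFinMat` and `splitWord`) swapping the two letters: the transposition
`X ↦ Xᵗ` of GIP Thm. 7, i.e. `τ : E^* ⊗ E → E^* ⊗ E` of Thm. 21, on basis vectors.
[cite: GesmundoIkenmeyerPanova2017, Thm. 7 (X ↦ Xᵗ) / Thm. 21 (τ)] -/
def swapPerm : Equiv.Perm (Fin (m * m)) :=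
  finProdFinEquiv.symm.trans ((Equiv.prodComm (Fin m) (Fin m)).trans finProdFinEquiv)

/-- `swapPerm` on an enumerated pair. [folklore] -/
@[simp]
theorem swapPerm_apply (i j : Fin m) :
    swapPerm m (finProdFinEquiv (i, j)) = finProdFinEquiv (j, i) := by
  simp [swapPerm]

/-- `swapPerm` is an involution. [folklore] -/
theorem swapPerm_mul_self : swapPerm m * swapPerm m = 1 := by
  ext x : 1
  obtain ⟨⟨i, j⟩, rfl⟩ := finProdFinEquiv.surjective x
  rw [Equiv.Perm.coe_mul, Function.comp_apply, swapPerm_apply, swapPerm_apply, Equiv.Perm.coe_one,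
    id]

/-- The transposition `X ↦ Xᵀ` as an element of `GL_{m²}(k)`: the permutation matrix of
`swapPerm`. [cite: GesmundoIkenmeyerPanova2017, Thm. 7 (X ↦ Xᵗ) / Thm. 21 (τ)] -/
def swapGL : GL (Fin (m * m)) k where
  val := (swapPerm m).permMatrix k
  inv := (swapPerm m).permMatrix k
  val_inv := by rw [← Matrix.permMatrix_mul, swapPerm_mul_self, Matrix.permMatrix_one]
  inv_val := by rw [← Matrix.permMatrix_mul, swapPerm_mul_self, Matrix.permMatrix_one]

/-- The matrix of `swapGL` (unfolding lemma). [folklore] -/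
@[simp]
theorem coe_swapGL : ((swapGL k m : GL (Fin (m * m)) k) : Matrix (Fin (m * m)) (Fin (m * m)) k) =
    (swapPerm m).permMatrix k :=
  rfl

variable {k m}

omit [Field k] in
/-- Entries of a permutation matrix: `P_{ij} = [σ i = j]`. [folklore] -/
theorem permMatrix_apply' {n : Type*} [DecidableEq n] [Zero k] [One k] (σ : Equiv.Perm n)
    (i j : n) : σ.permMatrix k i j = if σ i = j then 1 else 0 := by
  simp only [Equiv.Perm.permMatrix, PEquiv.toMatrix_apply, Equiv.toPEquiv_apply, Option.mem_def,
    Option.some.injEq]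

/-- **The transposition acts on functions of words by swapping the letters**:
`(swapGL · x)(w) = x(swap ∘ w)`. [folklore] -/
theorem wordRep_swapGL_apply {D : ℕ} (x : Word (m * m) D → k) (w : Word (m * m) D) :
    wordRep k (m * m) D (swapGL k m) x w = x (⇑(swapPerm m) ∘ w) := by
  rw [wordRep_apply, Finset.sum_eq_single (⇑(swapPerm m) ∘ w)]
  · rw [coe_swapGL, Finset.prod_eq_one (fun p _ => by
      rw [permMatrix_apply', Function.comp_apply, if_pos rfl]), one_mul]
  · intro w' _ hw'
    obtain ⟨p, hp⟩ := Function.ne_iff.mp hw'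
    rw [coe_swapGL, Finset.prod_eq_zero (Finset.mem_univ p), zero_mul]
    rw [permMatrix_apply', if_neg]
    intro h
    exact hp (by rw [Function.comp_apply]; exact h.symm)
  · intro h
    exact absurd (Finset.mem_univ _) h

/-- The matrix of a vector of `W^{⊗D}`, `W = E ⊗ F`: rows indexed by `E`-words, columns by
`F`-words (`splitFun` as a `Matrix`). Fulton–Harris Ex. 6.11; BLMW §5.2. [folklore] -/
def splitMat {D : ℕ} (x : Word (m * m) D → k) : Matrix (Word m D) (Word m D) k :=
  Matrix.of fun u v => splitFun k m D x (u, v)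

/-- Entries of `splitMat` (unfolding lemma). [folklore] -/
@[simp]
theorem splitMat_apply {D : ℕ} (x : Word (m * m) D → k) (u v : Word m D) :
    splitMat x u v = x ((splitWord m D).symm (u, v)) :=
  rfl

/-- `splitMat x = 0 ↔ x = 0` (splitting words is a bijection). [folklore] -/
theorem splitMat_eq_zero_iff {D : ℕ} (x : Word (m * m) D → k) : splitMat x = 0 ↔ x = 0 := by
  constructor
  · intro h
    funext w
    have := congr_fun (congr_fun h (splitWord m D w).1) (splitWord m D w).2
    rw [splitMat_apply, Prod.mk.eta, Equiv.symm_apply_apply] at this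
    exact this
  · rintro rfl
    rfl

/-- **A vector fixed by the transposition has a symmetric matrix.** [folklore] -/
theorem splitMat_transpose_of_swap_fixed {D : ℕ} {x : Word (m * m) D → k}
    (hx : wordRep k (m * m) D (swapGL k m) x = x) : (splitMat x)ᵀ = splitMat x := by
  ext u v
  rw [Matrix.transpose_apply, splitMat_apply, splitMat_apply]
  conv_rhs => rw [← hx, wordRep_swapGL_apply]
  congr 1
  funext p
  simp [splitWord_symm_apply]

/-- **The action of a Kronecker product on matrices of vectors**: `a ⊗ b` acts by
`M ↦ a^{⊗D} M (b^{⊗D})ᵀ` (`splitFun_wordRep_kronFin` in matrix form). Fulton–Harris Ex. 6.11.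
[folklore] -/
theorem splitMat_wordRep_kronFin {D : ℕ} (a b : GL (Fin m) k) (x : Word (m * m) D → k) :
    splitMat (wordRep k (m * m) D (kronFin k m a b) x) =
      kronPow (a : Matrix (Fin m) (Fin m) k) * splitMat x *
        (kronPow (D := D) (b : Matrix (Fin m) (Fin m) k))ᵀ := by
  ext u v
  change splitFun k m D (wordRep k (m * m) D (kronFin k m a b) x) (u, v) = _
  rw [splitFun_wordRep_kronFin]
  simp only [Matrix.mul_apply, Matrix.transpose_apply, kronPow_apply, splitMat_apply, splitFun_apply,
    Finset.sum_mul]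
  rw [Finset.sum_comm]
  refine Finset.sum_congr rfl fun v' _ => Finset.sum_congr rfl fun u' _ => ?_
  ring

/-- **A vector fixed by all `a ⊗ (a⁻¹)ᵀ` has a matrix commuting with `GL_m`**
(`a^{⊗D} M (a^{⊗D})⁻¹ = M`): the `GL(E)`-invariants of `(E ⊗ E^*)^{⊗D} = End(E^{⊗D})` are the
`GL(E)`-equivariant endomorphisms (GIP §4, proof of Prop. 22: "`𝒮₀` is the image of `GL(E)`
... via the adjoint representation"). [cite: GesmundoIkenmeyerPanova2017, §4 Prop. 22 (proof)] -/
theorem isGLCommuting_splitMat_of_fixed {D : ℕ} {x : Word (m * m) D → k}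
    (hx : ∀ a : GL (Fin m) k, wordRep k (m * m) D (kronFin k m a (transposeGL k a⁻¹)) x = x) :
    IsGLCommuting k (splitMat x) := by
  intro g
  have h := congrArg splitMat (hx g)
  rw [splitMat_wordRep_kronFin, coe_transposeGL, kronPow_transpose, Matrix.transpose_transpose] at h
  have hinv : kronPow (D := D) ((g⁻¹ : GL (Fin m) k) : Matrix (Fin m) (Fin m) k) *
      kronPow (g : Matrix (Fin m) (Fin m) k) = 1 := by
    rw [← kronPow_mul, ← Units.val_mul, inv_mul_cancel, Units.val_one, kronPow_one]
  have h' := congrArg (fun M => M * kronPow (D := D) (g : Matrix (Fin m) (Fin m) k)) h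
  rw [Matrix.mul_assoc, hinv, Matrix.mul_one] at h'
  rw [← kronPow_eq_tensorPowerMatrix]
  exact h'

variable (k m)

/-- **`a ⊗ (a⁻¹)ᵀ` stabilises `Pow^n_m`** in the lexicographic matrix variables (transport of
`linSubst_kronecker_powTrace_conj` along `rename toLex`, `rename_linSubst`).
[cite: GesmundoIkenmeyerPanova2017, Thm. 7] -/
theorem linSubstRep_reindexGL_kronFin_powFormLex (a : GL (Fin m) k) (n : ℕ) :
    Literature.Computability.AlgebraicComplexity.linSubstRep (MatIdx m) k
        (reindexGL (k := k) (matIdxEquiv m) (kronFin k m a (transposeGL k a⁻¹)))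
        (powFormLex k m n) = powFormLex k m n := by
  rw [Literature.Computability.AlgebraicComplexity.linSubstRep_apply, coe_reindexGL_kronFin,
    powFormLex, coe_transposeGL]
  have h := rename_linSubst (toLex : (Fin m × Fin m) ≃ MatIdx m)
    ((a : Matrix (Fin m) (Fin m) k) ⊗ₖ ((a⁻¹ : GL (Fin m) k) : Matrix (Fin m) (Fin m) k)ᵀ)
    (powTrace k m n)
  rw [linSubst_kronecker_powTrace_conj a n] at h
  exact h.symm

/-- The transposition of the lexicographic matrix variables, `X_{(i,j)} ↦ X_{(j,i)}`.
[cite: GesmundoIkenmeyerPanova2017, Thm. 7 (X ↦ Xᵗ) / Thm. 21 (τ)] -/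
def swapPermLex : Equiv.Perm (MatIdx m) :=
  (toLex : Fin m × Fin m ≃ MatIdx m).symm.trans ((Equiv.prodComm (Fin m) (Fin m)).trans toLex)

omit [Field k] in
/-- `swapPermLex` on a pair (unfolding lemma). [folklore] -/
@[simp]
theorem swapPermLex_toLex (i j : Fin m) : swapPermLex m (toLex (i, j)) = toLex (j, i) :=
  rfl

/-- The lexicographic enumeration on a pair: `(matIdxEquiv m)⁻¹ (toLex (i,j)) = e(i,j)`.
[folklore] -/
theorem matIdxEquiv_symm_toLex (i j : Fin m) :
    (matIdxEquiv m).symm (toLex (i, j)) = finProdFinEquiv (i, j) := by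
  rw [OrderIso.symm_apply_eq, matIdxEquiv_apply, Equiv.symm_apply_apply]

/-- The transposition `swapGL`, reindexed to the matrix variables, is the permutation matrix of
`swapPermLex`. [folklore] -/
theorem coe_reindexGL_swapGL :
    ((reindexGL (k := k) (matIdxEquiv m) (swapGL k m) : GL (MatIdx m) k) :
        Matrix (MatIdx m) (MatIdx m) k) = (swapPermLex m).permMatrix k := by
  ext x y
  obtain ⟨⟨i, j⟩, rfl⟩ := (toLex : Fin m × Fin m ≃ MatIdx m).surjective x
  rw [coe_reindexGL, Matrix.submatrix_apply, coe_swapGL, permMatrix_apply', permMatrix_apply']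
  change (if swapPerm m ((matIdxEquiv m).symm (toLex (i, j))) = (matIdxEquiv m).symm y then (1 : k)
    else 0) = if swapPermLex m (toLex (i, j)) = y then 1 else 0
  rw [matIdxEquiv_symm_toLex, swapPerm_apply, swapPermLex_toLex]
  congr 1
  apply propext
  constructor
  · intro h
    have := congrArg (matIdxEquiv m) h
    rwa [OrderIso.apply_symm_apply, matIdxEquiv_apply, Equiv.symm_apply_apply] at this
  · rintro rfl
    rw [matIdxEquiv_symm_toLex]

/-- **The transposition stabilises `Pow^n_m`** in the lexicographic matrix variables.
[cite: GesmundoIkenmeyerPanova2017, Thm. 7] -/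
theorem linSubstRep_reindexGL_swapGL_powFormLex (n : ℕ) :
    Literature.Computability.AlgebraicComplexity.linSubstRep (MatIdx m) k
        (reindexGL (k := k) (matIdxEquiv m) (swapGL k m)) (powFormLex k m n) = powFormLex k m n := by
  rw [Literature.Computability.AlgebraicComplexity.linSubstRep_apply, coe_reindexGL_swapGL,
    Literature.Computability.AlgebraicComplexity.linSubst_permMatrix, powFormLex, rename_rename]
  have hfun : (⇑(swapPermLex m).symm ∘ (toLex : Fin m × Fin m → MatIdx m)) = toLex ∘ Prod.swap := by
    funext ij
    obtain ⟨i, j⟩ := ij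
    rw [Function.comp_apply, Function.comp_apply, Equiv.symm_apply_eq, Prod.swap_prod_mk]
    rfl
  rw [hfun, ← rename_rename, rename_swap_powTrace]

end Stabilizer

end Literature.NumberTheory.DiophantineGeometry
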